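import Literature.Barriers.RiemannHypothesis.EpsteinZetaChowlaSelbergLineTheta
import HarnessLib

/-!
# The lattice-line sum `Σ_{m∈ℤ} ((m+α)² + y²)^{−s}`: the `K`-Bessel expansion

Fourth proof file towards `Literature.Barriers.RiemannHypothesis.BatemanGrosswald1964_thm1`
(the Chowla–Selberg formula, Bateman–Grosswald 1964, Theorem 1); no new definitions. For `y > 0`,
real `α` and `Re s > ½` we prove the classical expansion of one line of the lattice sum
(Rankin 1953; Bateman–Grosswald 1964, proof of Theorem 1):

`Σ_{m∈ℤ} ((m+α)² + y²)^{−s}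
   = y^{1−2s} π^{½} Γ(s−½)/Γ(s) + (4π^s/Γ(s)) y^{½−s} Σ_{m≥1} m^{s−½} cos(2πmα) K_{s−½}(2πmy)`

(`tsum_sq_add_sq_cpow_neg_eq`), continuing `EpsteinZetaChowlaSelbergLineTheta.lean` (Mellin
transform of the theta series of the line, Poisson summation, termwise Mellin transforms):

4. the interchange of sum and integral for the dual series
   (Mathlib `hasSum_integral_of_summable_integral_norm`; `hasSum_integral_dualTerm`,
   `tsum_quad_cpow_eq_tsum_integral`);
5. folding `n ↔ −n`: `e^{−2πiαn} + e^{2πiαn} = 2cos(2πnα)` (`tsum_quad_cpow_eq_integral_add_tsum`);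
6. evaluation of the integrals and the algebra of the main term
   `π^s/Γ(s) · (πy²)^{½−s} Γ(s−½) = y^{1−2s} π^{½} Γ(s−½)/Γ(s)`.

## References

* [BatemanGrosswald1964] P. T. Bateman, E. Grosswald, *On Epstein's zeta function*, Acta Arith. 9
  (1964) 365–373, Theorem 1 and its proof ((3)–(4); "Added in proof": the formula is due to
  Rankin, Proc. Glasgow Math. Assoc. 1 (1953) 149–158).
-/

noncomputable section

open MeasureTheory Set Filter Real Complex
open scoped Topology

namespace Literature.Barriers.RiemannHypothesis

open Literature.Analysis.FunctionSpaces
open Literature.Analysis.Complex.Polya1926 (polyaM polyaM_nonneg)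

/-! ## Step 4: interchange of sum and integral -/

/-- Each dual term is integrable on `(0, ∞)` (`Re s > ½`; for `n ≠ 0` every `s` would do).
[folklore] -/
theorem integrableOn_dualTerm {y : ℝ} (hy : 0 < y) (α : ℝ) {s : ℂ} (hs : 1 / 2 < s.re) (n : ℤ) :
    IntegrableOn (fun t : ℝ => (t : ℂ) ^ (s - 1) * (Complex.exp (-2 * π * I * α * n) *
        ((t ^ (-(1 / 2 : ℝ)) * Real.exp (-(π * y ^ 2 * t + π * (n : ℝ) ^ 2 / t)) : ℝ) : ℂ)))
      (Ioi 0) := by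
  have hker : IntegrableOn (fun t : ℝ => (t : ℂ) ^ ((s - 1 / 2) - 1) *
      (Real.exp (-(π * y ^ 2 * t + π * (n : ℝ) ^ 2 / t)) : ℂ)) (Ioi 0) := by
    rcases eq_or_ne n 0 with rfl | hn
    · exact (integral_dualKernel_zero hy hs).2
    · exact (integral_dualKernel_ne_zero hy s hn).2
  refine IntegrableOn.congr_fun (hker.const_mul (Complex.exp (-2 * π * I * α * n)))
    (fun t ht => ?_) measurableSet_Ioi
  exact (dualTerm_eq ht y α s n).symm

/-- **The interchange**: `Σ_n ∫₀^∞ (n-th dual term) = ∫₀^∞ Σ_n (n-th dual term)` as a `HasSum` over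
`ℤ` (Mathlib `hasSum_integral_of_summable_integral_norm`). [folklore] -/
theorem hasSum_integral_dualTerm {y : ℝ} (hy : 0 < y) (α : ℝ) {s : ℂ} (hs : 1 / 2 < s.re) :
    HasSum (fun n : ℤ => ∫ t in Ioi (0 : ℝ), (t : ℂ) ^ (s - 1) * (Complex.exp (-2 * π * I * α * n) *
        ((t ^ (-(1 / 2 : ℝ)) * Real.exp (-(π * y ^ 2 * t + π * (n : ℝ) ^ 2 / t)) : ℝ) : ℂ)))
      (∫ t in Ioi (0 : ℝ), ∑' n : ℤ, (t : ℂ) ^ (s - 1) * (Complex.exp (-2 * π * I * α * n) *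
        ((t ^ (-(1 / 2 : ℝ)) * Real.exp (-(π * y ^ 2 * t + π * (n : ℝ) ^ 2 / t)) : ℝ) : ℂ))) :=
  hasSum_integral_of_summable_integral_norm (μ := volume.restrict (Ioi 0))
    (integrableOn_dualTerm hy α hs) (summable_integral_norm_dualTerm hy α hs)

/-- The Mellin transform of the theta series of the line is the integral of the summed dual terms.
[folklore] -/
theorem mellin_lineTheta_eq_integral_tsum (y α : ℝ) (s : ℂ) :
    mellin (fun t => ∑' m : ℤ, (Real.exp (-π * (((m : ℝ) + α) ^ 2 + y ^ 2) * t) : ℂ)) s =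
      ∫ t in Ioi (0 : ℝ), ∑' n : ℤ, (t : ℂ) ^ (s - 1) * (Complex.exp (-2 * π * I * α * n) *
        ((t ^ (-(1 / 2 : ℝ)) * Real.exp (-(π * y ^ 2 * t + π * (n : ℝ) ^ 2 / t)) : ℝ) : ℂ)) := by
  unfold mellin
  refine setIntegral_congr_fun measurableSet_Ioi fun t ht => ?_
  simp only [smul_eq_mul]
  rw [lineTheta_eq_tsum_dual y α ht, ← tsum_mul_left]

/-- The `n`-th integrated dual term is `e^{−2πiαn} I_n(s)` with
`I_n(s) = ∫₀^∞ t^{(s−½)−1} e^{−πy²t−πn²/t} dt`. [folklore] -/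
theorem integral_dualTerm_eq (y α : ℝ) (s : ℂ) (n : ℤ) :
    (∫ t in Ioi (0 : ℝ), (t : ℂ) ^ (s - 1) * (Complex.exp (-2 * π * I * α * n) *
        ((t ^ (-(1 / 2 : ℝ)) * Real.exp (-(π * y ^ 2 * t + π * (n : ℝ) ^ 2 / t)) : ℝ) : ℂ))) =
      Complex.exp (-2 * π * I * α * n) * ∫ t in Ioi (0 : ℝ), (t : ℂ) ^ ((s - 1 / 2) - 1) *
        (Real.exp (-(π * y ^ 2 * t + π * (n : ℝ) ^ 2 / t)) : ℂ) := by
  rw [← integral_const_mul]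
  exact setIntegral_congr_fun measurableSet_Ioi fun t ht => dualTerm_eq ht y α s n

/-- **Steps 1–4 combined**: for `Re s > ½`,
`π^{−s}Γ(s) Σ_m q_m^{−s} = Σ_{n∈ℤ} e^{−2πiαn} I_n(s)` (both sides as sums of convergent series).
[cite: BatemanGrosswald1964, proof of Theorem 1] -/
theorem tsum_quad_cpow_eq_tsum_integral {y : ℝ} (hy : 0 < y) (α : ℝ) {s : ℂ} (hs : 1 / 2 < s.re) :
    (∑' m : ℤ, (π : ℂ) ^ (-s) * Complex.Gamma s * 1 / ((((m : ℝ) + α) ^ 2 + y ^ 2 : ℝ) : ℂ) ^ s) =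
      ∑' n : ℤ, Complex.exp (-2 * π * I * α * n) * ∫ t in Ioi (0 : ℝ), (t : ℂ) ^ ((s - 1 / 2) - 1) *
        (Real.exp (-(π * y ^ 2 * t + π * (n : ℝ) ^ 2 / t)) : ℂ) := by
  rw [(hasSum_mellin_lineTheta hy α hs).tsum_eq, mellin_lineTheta_eq_integral_tsum,
    ← (hasSum_integral_dualTerm hy α hs).tsum_eq]
  exact tsum_congr fun n => integral_dualTerm_eq y α s n

/-! ## Step 5: folding `n ↔ −n` and the final formula -/

/-- The integrated dual terms `J_n = e^{−2πiαn} I_n(s)` are summable over `n ∈ ℤ` (`Re s > ½`).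
[folklore] -/
theorem summable_dualJ {y : ℝ} (hy : 0 < y) (α : ℝ) {s : ℂ} (hs : 1 / 2 < s.re) :
    Summable fun n : ℤ => Complex.exp (-2 * π * I * α * n) * ∫ t in Ioi (0 : ℝ),
      (t : ℂ) ^ ((s - 1 / 2) - 1) * (Real.exp (-(π * y ^ 2 * t + π * (n : ℝ) ^ 2 / t)) : ℂ) :=
  (hasSum_integral_dualTerm hy α hs).summable.congr fun n => integral_dualTerm_eq y α s n

/-- `J_n + J_{−n} = 2cos(2πnα) I_n(s)` (`I_{−n} = I_n`, `e^{−iθ} + e^{iθ} = 2cos θ`). [folklore] -/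
theorem dualJ_add_dualJ_neg (y α : ℝ) (s : ℂ) (n : ℤ) :
    (Complex.exp (-2 * π * I * α * n) * ∫ t in Ioi (0 : ℝ),
        (t : ℂ) ^ ((s - 1 / 2) - 1) * (Real.exp (-(π * y ^ 2 * t + π * (n : ℝ) ^ 2 / t)) : ℂ)) +
      (Complex.exp (-2 * π * I * α * (-n : ℤ)) * ∫ t in Ioi (0 : ℝ),
        (t : ℂ) ^ ((s - 1 / 2) - 1) * (Real.exp (-(π * y ^ 2 * t + π * ((-n : ℤ) : ℝ) ^ 2 / t)) : ℂ)) =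
      2 * (Real.cos (2 * π * n * α) : ℂ) * ∫ t in Ioi (0 : ℝ),
        (t : ℂ) ^ ((s - 1 / 2) - 1) * (Real.exp (-(π * y ^ 2 * t + π * (n : ℝ) ^ 2 / t)) : ℂ) := by
  have e : ∀ t : ℝ, π * ((-n : ℤ) : ℝ) ^ 2 / t = π * (n : ℝ) ^ 2 / t := by
    intro t; push_cast; ring
  simp_rw [e]
  rw [← add_mul]
  congr 1
  rw [Complex.ofReal_cos, Complex.two_cos]
  push_cast
  rw [show (2 : ℂ) * π * n * α * I = -(-2 * π * I * α * n) by ring, show -2 * (π : ℂ) * I * α * (-(n : ℂ)) =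
    -(-2 * π * I * α * n) by ring]
  ring_nf

/-- **Steps 1–5: `π^{−s}Γ(s) Σ_m q_m^{−s} = I₀(s) + Σ_{n≥1} 2cos(2πnα) I_n(s)`** (`Re s > ½`), with
`I_n(s) = ∫₀^∞ t^{(s−½)−1} e^{−πy²t−πn²/t} dt`. [cite: BatemanGrosswald1964, proof of Theorem 1] -/
theorem tsum_quad_cpow_eq_integral_add_tsum {y : ℝ} (hy : 0 < y) (α : ℝ) {s : ℂ} (hs : 1 / 2 < s.re) :
    (∑' m : ℤ, (π : ℂ) ^ (-s) * Complex.Gamma s * 1 / ((((m : ℝ) + α) ^ 2 + y ^ 2 : ℝ) : ℂ) ^ s) =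
      (∫ t in Ioi (0 : ℝ), (t : ℂ) ^ ((s - 1 / 2) - 1) *
          (Real.exp (-(π * y ^ 2 * t + π * ((0 : ℤ) : ℝ) ^ 2 / t)) : ℂ)) +
        ∑' n : ℕ, 2 * (Real.cos (2 * π * ((n : ℤ) + 1 : ℤ) * α) : ℂ) * ∫ t in Ioi (0 : ℝ),
          (t : ℂ) ^ ((s - 1 / 2) - 1) *
            (Real.exp (-(π * y ^ 2 * t + π * (((n : ℤ) + 1 : ℤ) : ℝ) ^ 2 / t)) : ℂ) := by
  have hJ := summable_dualJ hy α hs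
  rw [tsum_quad_cpow_eq_tsum_integral hy α hs]
  set J : ℤ → ℂ := fun n => Complex.exp (-2 * π * I * α * n) * ∫ t in Ioi (0 : ℝ),
      (t : ℂ) ^ ((s - 1 / 2) - 1) * (Real.exp (-(π * y ^ 2 * t + π * (n : ℝ) ^ 2 / t)) : ℂ)
    with hJdef
  have hi1 : Function.Injective fun n : ℕ => ((n : ℤ) + 1 : ℤ) := fun a b h => by simpa using h
  have hi2 : Function.Injective fun n : ℕ => (-((n : ℤ) + 1) : ℤ) := fun a b h => by simpa using h
  have h1 : Summable fun n : ℕ => J ((n : ℤ) + 1) := hJ.comp_injective hi1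
  have h2 : Summable fun n : ℕ => J (-((n : ℤ) + 1)) := hJ.comp_injective hi2
  rw [tsum_of_add_one_of_neg_add_one h1 h2, add_comm _ (J 0), add_assoc, ← h1.tsum_add h2]
  congr 1
  · simp only [hJdef, Int.cast_zero, mul_zero, Complex.exp_zero, one_mul]
  · refine tsum_congr fun n => ?_
    simp only [hJdef]
    exact dualJ_add_dualJ_neg y α s ((n : ℤ) + 1)

/-! ## Step 6: evaluation of the integrals and the expansion -/

/-- `(y²)^w = y^{2w}` for `y > 0` and complex `w`. [folklore] -/
theorem ofReal_sq_cpow {y : ℝ} (hy : 0 < y) (w : ℂ) : ((y ^ 2 : ℝ) : ℂ) ^ w = (y : ℂ) ^ (2 * w) := by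
  have hy0 : (y : ℂ) ≠ 0 := Complex.ofReal_ne_zero.2 hy.ne'
  have hy2 : ((y ^ 2 : ℝ) : ℂ) ≠ 0 := by exact_mod_cast (pow_pos hy 2).ne'
  rw [Complex.cpow_def_of_ne_zero hy2, Complex.cpow_def_of_ne_zero hy0,
    ← Complex.ofReal_log (pow_pos hy 2).le, Real.log_pow, ← Complex.ofReal_log hy.le]
  congr 1
  push_cast
  ring

/-- The main-term algebra: `π^s/Γ(s) · (πy²)^{−(s−½)} Γ(s−½) = y^{1−2s} π^{½} Γ(s−½)/Γ(s)`.
[folklore] -/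
theorem mainTerm_algebra {y : ℝ} (hy : 0 < y) (s : ℂ) :
    (π : ℂ) ^ s / Complex.Gamma s *
        ((1 / ((π * y ^ 2 : ℝ) : ℂ)) ^ (s - 1 / 2) * Complex.Gamma (s - 1 / 2)) =
      (y : ℂ) ^ (1 - 2 * s) * (π : ℂ) ^ (1 / 2 : ℂ) * Complex.Gamma (s - 1 / 2) /
        Complex.Gamma s := by
  have hπ : (π : ℂ) ≠ 0 := Complex.ofReal_ne_zero.2 Real.pi_pos.ne'
  have hy0 : (y : ℂ) ≠ 0 := Complex.ofReal_ne_zero.2 hy.ne'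
  have hr : 0 < π * y ^ 2 := by positivity
  have e1 : (1 / ((π * y ^ 2 : ℝ) : ℂ)) ^ (s - 1 / 2) =
      (π : ℂ) ^ (-(s - 1 / 2)) * (y : ℂ) ^ (2 * (-(s - 1 / 2))) := by
    rw [one_div, Complex.inv_cpow _ _ (by rw [Complex.arg_ofReal_of_nonneg hr.le]; exact
      Real.pi_pos.ne), ← Complex.cpow_neg, Complex.ofReal_mul,
      Complex.mul_cpow_ofReal_nonneg Real.pi_pos.le (sq_nonneg y), ofReal_sq_cpow hy]
  have e2 : (π : ℂ) ^ s * (π : ℂ) ^ (-(s - 1 / 2)) = (π : ℂ) ^ (1 / 2 : ℂ) := by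
    rw [← Complex.cpow_add _ _ hπ]; congr 1; ring
  have e3 : (y : ℂ) ^ (2 * (-(s - 1 / 2))) = (y : ℂ) ^ (1 - 2 * s) := by congr 1; ring
  rw [e1, e3]
  calc (π : ℂ) ^ s / Complex.Gamma s *
        ((π : ℂ) ^ (-(s - 1 / 2)) * (y : ℂ) ^ (1 - 2 * s) * Complex.Gamma (s - 1 / 2))
      = ((π : ℂ) ^ s * (π : ℂ) ^ (-(s - 1 / 2))) * (y : ℂ) ^ (1 - 2 * s) *
          Complex.Gamma (s - 1 / 2) / Complex.Gamma s := by ring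
    _ = _ := by rw [e2]; ring

/-- The value of `I_{n+1}(s)` in natural-number form:
`I_{n+1}(s) = 2 (n+1)^{s−½} y^{½−s} K_{s−½}(2π(n+1)y)`. [folklore] -/
theorem integral_dualKernel_succ {y : ℝ} (hy : 0 < y) (s : ℂ) (n : ℕ) :
    (∫ t in Ioi (0 : ℝ), (t : ℂ) ^ ((s - 1 / 2) - 1) *
        (Real.exp (-(π * y ^ 2 * t + π * (((n : ℤ) + 1 : ℤ) : ℝ) ^ 2 / t)) : ℂ)) =
      2 * (((n + 1 : ℕ) : ℂ) ^ (s - 1 / 2) * (y : ℂ) ^ (1 / 2 - s)) *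
        besselK (s - 1 / 2) ((2 * π * ((n + 1 : ℕ) : ℝ) * y : ℝ) : ℂ) := by
  have hn : ((n : ℤ) + 1 : ℤ) ≠ 0 := by omega
  have h := (integral_dualKernel_ne_zero hy s hn).1
  have habs : |(((n : ℤ) + 1 : ℤ) : ℝ)| = ((n + 1 : ℕ) : ℝ) := by
    push_cast
    exact abs_of_nonneg (by positivity)
  rw [habs] at h
  rw [h, ofReal_div_cpow (by positivity) hy, show -(s - 1 / 2) = 1 / 2 - s by ring]
  push_cast
  ring

/-- **The Fourier–Bessel expansion of a lattice-line sum** (Rankin; Bateman–Grosswald, proof of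
Theorem 1): for `y > 0`, real `α` and `Re s > ½`,
`Σ_{m∈ℤ} ((m+α)² + y²)^{−s} = y^{1−2s} π^{½} Γ(s−½)/Γ(s)
   + (4π^s/Γ(s)) y^{½−s} Σ_{m≥1} m^{s−½} cos(2πmα) K_{s−½}(2πmy)`.
[cite: BatemanGrosswald1964, Theorem 1 (3)–(4) and proof] -/
theorem tsum_sq_add_sq_cpow_neg_eq {y : ℝ} (hy : 0 < y) (α : ℝ) {s : ℂ} (hs : 1 / 2 < s.re) :
    (∑' m : ℤ, ((((m : ℝ) + α) ^ 2 + y ^ 2 : ℝ) : ℂ) ^ (-s)) =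
      (y : ℂ) ^ (1 - 2 * s) * (π : ℂ) ^ (1 / 2 : ℂ) * Complex.Gamma (s - 1 / 2) / Complex.Gamma s +
        4 * (π : ℂ) ^ s / Complex.Gamma s * (y : ℂ) ^ (1 / 2 - s) *
          ∑' m : ℕ, ((m + 1 : ℕ) : ℂ) ^ (s - 1 / 2) * (Real.cos (2 * π * ((m + 1 : ℕ) : ℝ) * α) : ℂ) *
            besselK (s - 1 / 2) ((2 * π * ((m + 1 : ℕ) : ℝ) * y : ℝ) : ℂ) := by
  have hs0 : 0 < s.re := by linarith
  have hπ : (π : ℂ) ≠ 0 := Complex.ofReal_ne_zero.2 Real.pi_pos.ne'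
  have hΓ : Complex.Gamma s ≠ 0 := Complex.Gamma_ne_zero_of_re_pos hs0
  have hc : (π : ℂ) ^ (-s) * Complex.Gamma s ≠ 0 :=
    mul_ne_zero (Complex.cpow_ne_zero_iff.2 (Or.inl hπ)) hΓ
  have key := tsum_quad_cpow_eq_integral_add_tsum hy α hs
  -- the left side is `π^{-s} Γ(s) Σ_m q_m^{-s}`
  have hL : (∑' m : ℤ, (π : ℂ) ^ (-s) * Complex.Gamma s * 1 / ((((m : ℝ) + α) ^ 2 + y ^ 2 : ℝ) : ℂ) ^ s) =
      (π : ℂ) ^ (-s) * Complex.Gamma s * ∑' m : ℤ, ((((m : ℝ) + α) ^ 2 + y ^ 2 : ℝ) : ℂ) ^ (-s) := by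
    rw [← tsum_mul_left]
    refine tsum_congr fun m => ?_
    rw [mul_one, div_eq_mul_inv, Complex.cpow_neg, Complex.cpow_neg]
  rw [hL, (integral_dualKernel_zero hy hs).1] at key
  simp_rw [integral_dualKernel_succ hy s] at key
  -- solve for the sum
  have hinv : ((π : ℂ) ^ (-s) * Complex.Gamma s)⁻¹ = (π : ℂ) ^ s / Complex.Gamma s := by
    rw [Complex.cpow_neg, mul_inv, inv_inv, div_eq_mul_inv]
  have key2 := congrArg (fun z => ((π : ℂ) ^ (-s) * Complex.Gamma s)⁻¹ * z) key
  simp only [inv_mul_cancel_left₀ hc] at key2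
  rw [key2, hinv, mul_add, mainTerm_algebra hy s, ← tsum_mul_left, ← tsum_mul_left]
  congr 1
  refine tsum_congr fun m => ?_
  push_cast
  ring

end Literature.Barriers.RiemannHypothesis
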